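import Summits.CriticalPhenomena.PercolationContinuityZ3.Theorems.PercNearOneGluingNoHeavyQuantGatedSliceMixLawWSide
import HarnessLib

/-!
# QUANT lane R8, T-DEC, leg (III), blob case — `LawDec.GatedSliceMixLaw'`, REGIME C1 PROVED: the shifted low `k₁ + a` a
# `t`-low, `k₂` a giant (`k₂ ≥ j+1`), both atoms `h`, `h + a` of the weak-mid law at most `j` (`h` not a `t`-low) — the exchange
# certificate at the balance point, whose single inequality collapses to top-affordability `y·k₂ ≤ S`

builds on p205010 (kernel theorem, internal audit signed; external expert review pending)

Support file (`--supports stmt-CriticalPhenomena-4575`), QUANT lane typer seat prim-quant-stmt (gen 30), rung R8 of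
`run/shared/lean/prim/quant/LADDER.md`.  Memo `run/shared/lean/prim/quant/prim-quant-stmt-g30/MIXLAW-MIXTURES-G30.md` §4.  Theorems only,
standard axioms, no sorries.  Tools: `…QuantGatedSliceMixLawExchange` (pair flows, conclusion wrapper), `…QuantGatedSliceMixLawWSide`
(`flowAtT_weakMidShare`, `weakMid_capacity_ge`).

THE REGIME.  Frame of `GatedSliceMixLaw'` (`0 < y < 1`, `0 ≤ z < 1`, `g ≤ 1`, `y ≤ (1−z)g`, `1 ≤ a`, `0 < S`, `y·M ≤ S`, `S < h ≤ min(j,M)`,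
`μ₂ = {k₁,k₂;λ}` of mean `S/(1−z)`, `t = S + ag(1−z)`) with: `2(k₁+a) < t` and `k₁ + a ≤ j` (both copies of the low are `t`-lows; `k₁ = 0` allowed),
`k₂ ≥ j + 1` (both copies of the top are giants), `h + a ≤ j` and `2h ≥ t` (both atoms of `W_h` are mids).  Signatures LLGGMM / LLGGmM of the
seat's census (≈ 20 % of the genuine instances).  The hypothesis `W_h ∉ D` of `GatedSliceMixLaw'` is NOT needed here.

THE CERTIFICATE (memo §3–§4).  Masses `m₁ = (1−z)(1−λ)(1−g)` at `k₁`, `m₁' = (1−z)(1−λ)g` at `ℓ := k₁+a`, `(1−z)λ` on the giants, `z` at `0`;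
`W = w₀δ₀ + W(h)δ_h + W(h+a)δ_{h+a}`, `w₀ = 1 − S/h`, `W(h) = (S/h)(1−g)`, `W(h+a) = (S/h)g`.  EITHER criterion E holds for `P` alone
(`y(z + m₁ + m₁') ≤ (1−y)(1−z)λ`; then `θ = 0`, `flowAtT_of_giants`), OR both nonzero lows of `P` are shipped ENTIRELY into the two mids of `W`
(each mid split between the two donors in the same proportion `π_i`; donor `i` absorbs `π_i K_i`, `K_i = Σ_m W(m)/usage(i,m)` over the
compatible mids), the whole zero mass of `W` and of `P` rides the giants of `P`, and the mixing ratio `ρ = θ/(1−θ) = m₁/K_{k₁} + m₁'/K_ℓ` is the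
BALANCE POINT (donated lows exactly fill `W`'s mids).  By the exchange lemma the mixture is DEC iff the zeros fit: `y(z + ρw₀) ≤ (1−y)(1−z)λ`.
THE INEQUALITY: `usage(i,m)·(m − t) ≤ t − i` (`usage_mid_mul_le`) and `Σ_m W(m)(m − t) = (S/h)(h − S + agz)` give `K_i ≥ (S/h)(h−S)/(t−i)`,
hence `ρ·w₀ ≤ (1−z)(1−λ)(t − k₁ − ag)/S`, and with `t − k₁ − ag = S − k₁ − agz` and `S − (1−z)(1−λ)k₁ = (1−z)λk₂` the zero inequality becomes
`y[λk₂ − (1−λ)agz] ≤ λS ⟸ y·k₂ ≤ y·M ≤ S` — top-affordability.  (Exact census of the seat: the relaxed certificate is TIGHT at `z = 0`, `g = 1`,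
`y = S/M`, `k₂ = M`; 20 000 regime instances / 0 failures, genuine or not.)

* **`LawDec.gatedSliceMixLaw_regimeC1`** — the conclusion of `GatedSliceMixLaw'` in regime C1.

[this work]; exchange architecture: this seat; flow form / criterion E / usage bounds: prim-quant-stmt g22–g27, arm-1 g39 (this lane).  Nothing
here is cited as a published result.  The gluing rows served [cite: KozmaNitzan2024, Conjecture 3 (p. 15)]; product measure
[cite: Grimmett1999, §1.3 p. 10].
-/

noncomputable section

namespace Summit.CriticalPhenomena.PercolationContinuityZ3.Theorems

namespace Quant

open Finset

/-- the two-point law `{lo, hi; g}` (as in `…QuantLawDEC`) -/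
local notation3 "TP[" lo ", " hi ", " g ", " h "]" =>
  (g : ℝ) * (if (h : ℕ) = (hi : ℕ) then (1 : ℝ) else 0) + (1 - (g : ℝ)) * (if (h : ℕ) = (lo : ℕ) then (1 : ℝ) else 0)

namespace LawDec
/-! ### Regime C1 -/

set_option maxHeartbeats 800000 in
/-- **`GatedSliceMixLaw'` IN REGIME C1** (`2(k₁+a) < t`, `k₁ + a ≤ j`, `k₂ ≥ j+1`, `h + a ≤ j`, `2h ≥ t`; `k₁ = 0` allowed): the conclusion
of `GatedSliceMixLaw'` (indeed of the refuted `GatedSliceMixLaw` — the hypothesis `W_h ∉ D` is not used in this regime).  See the file header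
for the certificate; `θ = 0` when criterion E holds for the moved law alone, else `θ = ρ/(1+ρ)` at the balance point. [this work] -/
theorem gatedSliceMixLaw_regimeC1 (y z g S lam : ℝ) (a j M h k₁ k₂ : ℕ)
    (hy0 : 0 < y) (hy1 : y < 1) (hz0 : 0 ≤ z) (hz1 : z < 1) (hg1 : g ≤ 1) (hyg : y ≤ (1 - z) * g) (hjM : j < M + a)
    (hS0 : 0 < S) (hta : y * (M : ℝ) ≤ S) (hhM : h ≤ M) (hSh : S < (h : ℝ))
    (hk : k₁ ≤ k₂) (hk₂M : k₂ ≤ M) (hlam0 : 0 ≤ lam) (hlam1 : lam ≤ 1)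
    (hmean : (1 - z) * ((k₁ : ℝ) + ((k₂ : ℝ) - k₁) * lam) = S)
    (hllow : 2 * ((k₁ + a : ℕ) : ℝ) < S + (a : ℝ) * g * (1 - z)) (hlj : k₁ + a ≤ j)
    (hk₂G : j + 1 ≤ k₂) (hhaj : h + a ≤ j) (hhmid : S + (a : ℝ) * g * (1 - z) ≤ 2 * (h : ℝ)) :
    ∃ θ : ℝ, 0 ≤ θ ∧ θ < 1 ∧
      DECAtT y (S + (a : ℝ) * g * (1 - z)) j (M + a)
        (fun p => θ * weakMidLaw S g h a p
          + (1 - θ) * (z * (if p = 0 then (1 : ℝ) else 0) + (1 - z) * slice (fun q => TP[k₁, k₂, lam, q]) a g p)) := by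
  classical
  set t : ℝ := S + (a : ℝ) * g * (1 - z) with ht
  -- basic positivity
  have h1z : 0 < 1 - z := by linarith
  have hg0 : 0 < g := by nlinarith
  have h1y : 0 < 1 - y := by linarith
  have ha0 : (0 : ℝ) ≤ a := Nat.cast_nonneg a
  have hh0 : (0 : ℝ) < h := lt_trans hS0 hSh
  have hk₁0 : (0 : ℝ) ≤ k₁ := Nat.cast_nonneg k₁
  have hSh' : 0 < S / (h : ℝ) := div_pos hS0 hh0
  have hw0 : 0 ≤ 1 - S / (h : ℝ) := by rw [sub_nonneg, div_le_one hh0]; exact hSh.le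
  have h1lam : 0 ≤ 1 - lam := by linarith
  have hagz : 0 ≤ (a : ℝ) * g * z := mul_nonneg (mul_nonneg ha0 hg0.le) hz0
  have hk1low : 2 * (k₁ : ℝ) < t := by push_cast at hllow; linarith
  have hyk₂ : y * (k₂ : ℝ) ≤ S := le_trans (mul_le_mul_of_nonneg_left (by exact_mod_cast hk₂M) hy0.le) hta
  have htaN : y * (((M + a : ℕ) : ℝ)) ≤ t := by
    push_cast; rw [ht]; nlinarith [mul_nonneg ha0 hg0.le]
  have htaha : y * ((h + a : ℕ) : ℝ) ≤ t := by
    have : ((h + a : ℕ) : ℝ) ≤ ((M + a : ℕ) : ℝ) := by exact_mod_cast (by omega : h + a ≤ M + a)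
    nlinarith
  -- masses of the moved law
  set m₁ : ℝ := (1 - z) * (1 - lam) * (1 - g) with hm₁
  set m₁' : ℝ := (1 - z) * (1 - lam) * g with hm₁'
  have hm₁0 : 0 ≤ m₁ := mul_nonneg (mul_nonneg h1z.le h1lam) (by linarith)
  have hm₁'0 : 0 ≤ m₁' := mul_nonneg (mul_nonneg h1z.le h1lam) hg0.le
  -- the law P below / above the layer
  have hPlow : ∀ l, l ≤ j →
      z * (if l = 0 then (1 : ℝ) else 0) + (1 - z) * slice (fun q => TP[k₁, k₂, lam, q]) a g l
        = z * (if l = 0 then (1 : ℝ) else 0) + m₁ * (if l = k₁ then (1 : ℝ) else 0) + m₁' * (if l = k₁ + a then (1 : ℝ) else 0) := by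
    intro l hl
    rw [movedTwoPoint_apply, if_neg (show l ≠ k₂ by omega), if_neg (show l ≠ k₂ + a by omega)]
    simp only [hm₁, hm₁']; ring
  have hsumlow : ∑ l ∈ Finset.range (j + 1),
      (z * (if l = 0 then (1 : ℝ) else 0) + (1 - z) * slice (fun q => TP[k₁, k₂, lam, q]) a g l) = z + m₁ + m₁' := by
    rw [Finset.sum_congr rfl (fun l hl => hPlow l (Nat.lt_succ_iff.1 (Finset.mem_range.1 hl)))]
    rw [Finset.sum_add_distrib, Finset.sum_add_distrib, sum_mul_indicator (fun _ => z) j 0 (by omega),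
      sum_mul_indicator (fun _ => m₁) j k₁ (by omega), sum_mul_indicator (fun _ => m₁') j (k₁ + a) hlj]
  have hsumall := sum_movedTwoPoint z lam g a k₁ k₂ (M + a) hk (by omega)
  have hsumIco : ∑ p ∈ Finset.Ico (j + 1) (M + a + 1),
      (z * (if p = 0 then (1 : ℝ) else 0) + (1 - z) * slice (fun q => TP[k₁, k₂, lam, q]) a g p) = (1 - z) * lam := by
    have := Finset.sum_range_add_sum_Ico (fun p =>
      z * (if p = 0 then (1 : ℝ) else 0) + (1 - z) * slice (fun q => TP[k₁, k₂, lam, q]) a g p) (show j + 1 ≤ M + a + 1 by omega)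
    rw [hsumall, hsumlow] at this
    have e : z + m₁ + m₁' = 1 - (1 - z) * lam := by simp only [hm₁, hm₁']; ring
    linarith
  have hPnn : ∀ p, 0 ≤ z * (if p = 0 then (1 : ℝ) else 0) + (1 - z) * slice (fun q => TP[k₁, k₂, lam, q]) a g p := by
    intro p; rw [movedTwoPoint_apply]
    have := mul_nonneg (mul_nonneg h1z.le hlam0) (show (0 : ℝ) ≤ 1 - g by linarith)
    have := mul_nonneg (mul_nonneg h1z.le hlam0) hg0.le
    refine add_nonneg (add_nonneg (add_nonneg (add_nonneg (mul_nonneg hz0 ?_) (mul_nonneg hm₁0 ?_)) (mul_nonneg hm₁'0 ?_))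
      (mul_nonneg (by assumption) ?_)) (mul_nonneg (by assumption) ?_) <;> split_ifs <;> norm_num
  -- CASE 1: criterion E for P alone ⟹ θ = 0
  by_cases hE : y / (1 - y) * (z + m₁ + m₁') ≤ (1 - z) * lam
  · have hP : FlowAtT y t j (M + a) (fun p => z * (if p = 0 then (1 : ℝ) else 0) + (1 - z) * slice (fun q => TP[k₁, k₂, lam, q]) a g p) := by
      refine flowAtT_of_giants y t j (M + a) _ hy0 hy1 hPnn ?_
      rw [hsumIco]
      refine le_trans (mul_le_mul_of_nonneg_left ?_ (div_pos hy0 h1y).le) hE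
      rw [← hsumlow]
      exact Finset.sum_le_sum fun l _ => by
        by_cases h2 : 2 * (l : ℝ) < t
        · rw [if_pos h2]
        · rw [if_neg h2]; exact hPnn l
    refine gatedSliceMixLaw_conclusion_of_flowAtT y z g S lam 0 a j M h k₁ k₂ hy0 hy1 hhM hk hk₂M le_rfl zero_lt_one ?_
    refine (congrArg (FlowAtT y t j (M + a)) (funext fun p => ?_)).mp hP
    ring
  -- CASE 2: the exchange certificate at the balance point
  have hlam_lt : lam < 1 := by
    by_contra hge
    have hl1 : lam = 1 := le_antisymm hlam1 (not_lt.1 hge)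
    apply hE
    rw [hl1] at hm₁ hm₁'
    have : m₁ = 0 := by rw [hm₁]; ring
    have : m₁' = 0 := by rw [hm₁']; ring
    simp only [*]
    rw [div_mul_eq_mul_div, div_le_iff₀ h1y]
    nlinarith
  have hm₁'pos : 0 < m₁' := mul_pos (mul_pos h1z (by linarith)) hg0
  -- capacities of the donors k₁ and ℓ = k₁ + a
  obtain ⟨K₁, hK₁⟩ : ∃ K : ℝ, K = (if t < (k₁ : ℝ) + h then S / h * (1 - g) / usage y t j k₁ h else 0)
      + S / h * g / usage y t j k₁ (h + a) := ⟨_, rfl⟩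
  obtain ⟨Kl, hKl⟩ : ∃ K : ℝ, K = (if t < ((k₁ + a : ℕ) : ℝ) + h then S / h * (1 - g) / usage y t j (k₁ + a) h else 0)
      + S / h * g / usage y t j (k₁ + a) (h + a) := ⟨_, rfl⟩
  have hK₁ge := weakMid_capacity_ge y t S g z j h a k₁ hy0 hy1 hg0.le hg1 hz0 hS0.le hSh ht hk1low hhaj htaha
  have hKlge := weakMid_capacity_ge y t S g z j h a (k₁ + a) hy0 hy1 hg0.le hg1 hz0 hS0.le hSh ht hllow hhaj htaha
  rw [← hK₁] at hK₁ge
  rw [← hKl] at hKlge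
  have htk₁ : 0 < t - k₁ := by linarith
  have htl : 0 < t - ((k₁ + a : ℕ) : ℝ) := by
    have : (0 : ℝ) ≤ ((k₁ + a : ℕ) : ℝ) := Nat.cast_nonneg _
    linarith
  have hc0 : 0 < S / h * ((h : ℝ) - S) := mul_pos hSh' (by linarith)
  have hK₁pos : 0 < K₁ := lt_of_lt_of_le (div_pos hc0 htk₁) hK₁ge
  have hKlpos : 0 < Kl := lt_of_lt_of_le (div_pos hc0 htl) hKlge
  -- the balance point
  obtain ⟨ρ, hρ⟩ : ∃ r : ℝ, r = m₁ / K₁ + m₁' / Kl := ⟨_, rfl⟩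
  have hρpos : 0 < ρ := by rw [hρ]; exact add_pos_of_nonneg_of_pos (div_nonneg hm₁0 hK₁pos.le) (div_pos hm₁'pos hKlpos)
  obtain ⟨θ, hθ⟩ : ∃ q : ℝ, q = ρ / (1 + ρ) := ⟨_, rfl⟩
  have hθ0 : 0 ≤ θ := by rw [hθ]; exact div_nonneg hρpos.le (by linarith)
  have hθ1 : θ < 1 := by rw [hθ, div_lt_one (by linarith)]; linarith
  have h1θ : 1 - θ = 1 / (1 + ρ) := by rw [hθ]; field_simp; ring
  have hθρ : θ = (1 - θ) * ρ := by rw [h1θ, hθ]; ring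
  obtain ⟨π₁, hπ₁⟩ : ∃ q : ℝ, q = m₁ / (ρ * K₁) := ⟨_, rfl⟩
  obtain ⟨πl, hπl⟩ : ∃ q : ℝ, q = m₁' / (ρ * Kl) := ⟨_, rfl⟩
  have hπ₁0 : 0 ≤ π₁ := by rw [hπ₁]; exact div_nonneg hm₁0 (mul_pos hρpos hK₁pos).le
  have hπl0 : 0 ≤ πl := by rw [hπl]; exact div_nonneg hm₁'0 (mul_pos hρpos hKlpos).le
  have hρne : ρ ≠ 0 := hρpos.ne'
  have hK₁ne : K₁ ≠ 0 := hK₁pos.ne'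
  have hKlne : Kl ≠ 0 := hKlpos.ne'
  have hπ₁K : ρ * (π₁ * K₁) = m₁ := by rw [hπ₁]; field_simp
  have hπlK : ρ * (πl * Kl) = m₁' := by rw [hπl]; field_simp
  have hπsum : π₁ + πl = 1 := by
    have h1 : ρ * π₁ = m₁ / K₁ := by rw [hπ₁]; field_simp
    have h2 : ρ * πl = m₁' / Kl := by rw [hπl]; field_simp
    have h3 : ρ * (π₁ + πl) = ρ * 1 := by rw [mul_add, h1, h2, mul_one, hρ]
    exact mul_left_cancel₀ hρne h3
  -- the W-side: both shares
  have hhaN : h + a ≤ M + a := by omega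
  have hcomp1 : t < (k₁ : ℝ) + ((h + a : ℕ) : ℝ) := by
    push_cast; have : (a : ℝ) * g * (1 - z) ≤ a := by nlinarith [mul_nonneg ha0 hg0.le]
    rw [ht]; linarith
  have hcompl : t < ((k₁ + a : ℕ) : ℝ) + ((h + a : ℕ) : ℝ) := by push_cast at hcomp1 ⊢; linarith
  have hk₁j : k₁ ≤ j := by omega
  have W1 := flowAtT_weakMidShare y t S g π₁ j (M + a) h a k₁ hy0 hy1 hg0.le hg1 hS0.le hπ₁0 hk₁j hk1low hhaN hhmid hcomp1
  have Wl := flowAtT_weakMidShare y t S g πl j (M + a) h a (k₁ + a) hy0 hy1 hg0.le hg1 hS0.le hπl0 hlj hllow hhaN hhmid hcompl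
  rw [← hK₁] at W1
  rw [← hKl] at Wl
  have hW' := FlowAtT.add W1 Wl
  -- the P-side: zeros ride the giants (criterion E) — THE inequality
  have hineq : y / (1 - y) * (z + ρ * (1 - S / h)) ≤ (1 - z) * lam := by
    -- ρ·w₀ ≤ (1−z)(1−λ)(t − k₁ − ag)/S
    have hb1 : m₁ / K₁ ≤ m₁ * (t - k₁) / (S / h * ((h : ℝ) - S)) := by
      rw [div_le_div_iff₀ hK₁pos hc0]
      have h1 : S / h * ((h : ℝ) - S) ≤ K₁ * (t - k₁) := (div_le_iff₀ htk₁).1 hK₁ge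
      calc m₁ * (S / h * ((h : ℝ) - S)) ≤ m₁ * (K₁ * (t - k₁)) := mul_le_mul_of_nonneg_left h1 hm₁0
        _ = m₁ * (t - k₁) * K₁ := by ring
    have hb2 : m₁' / Kl ≤ m₁' * (t - ((k₁ + a : ℕ) : ℝ)) / (S / h * ((h : ℝ) - S)) := by
      rw [div_le_div_iff₀ hKlpos hc0]
      have h1 : S / h * ((h : ℝ) - S) ≤ Kl * (t - ((k₁ + a : ℕ) : ℝ)) := (div_le_iff₀ htl).1 hKlge
      calc m₁' * (S / h * ((h : ℝ) - S)) ≤ m₁' * (Kl * (t - ((k₁ + a : ℕ) : ℝ))) := mul_le_mul_of_nonneg_left h1 hm₁'0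
        _ = m₁' * (t - ((k₁ + a : ℕ) : ℝ)) * Kl := by ring
    have hρle : ρ * (1 - S / h) ≤ (m₁ * (t - k₁) + m₁' * (t - ((k₁ + a : ℕ) : ℝ))) / S := by
      have hsum : ρ ≤ (m₁ * (t - k₁) + m₁' * (t - ((k₁ + a : ℕ) : ℝ))) / (S / h * ((h : ℝ) - S)) := by
        rw [hρ, add_div]; exact add_le_add hb1 hb2
      have hne1 : (h : ℝ) ≠ 0 := hh0.ne'
      have hne2 : (h : ℝ) - S ≠ 0 := by intro h0; linarith
      have hne3 : S ≠ 0 := hS0.ne'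
      have e : (m₁ * (t - k₁) + m₁' * (t - ((k₁ + a : ℕ) : ℝ))) / (S / h * ((h : ℝ) - S)) * (1 - S / h)
          = (m₁ * (t - k₁) + m₁' * (t - ((k₁ + a : ℕ) : ℝ))) / S := by
        rw [show (1 : ℝ) - S / h = ((h : ℝ) - S) / h by field_simp]
        field_simp
      calc ρ * (1 - S / h) ≤ (m₁ * (t - k₁) + m₁' * (t - ((k₁ + a : ℕ) : ℝ))) / (S / h * ((h : ℝ) - S)) * (1 - S / h) :=
            mul_le_mul_of_nonneg_right hsum hw0
        _ = _ := e
    -- the income of the lows: m₁(t−k₁) + m₁'(t−ℓ) = (1−z)(1−λ)(S − k₁ − agz)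
    have hinc : m₁ * (t - k₁) + m₁' * (t - ((k₁ + a : ℕ) : ℝ)) = (1 - z) * (1 - lam) * (S - k₁ - (a : ℝ) * g * z) := by
      simp only [hm₁, hm₁']; push_cast; rw [ht]; ring
    rw [hinc] at hρle
    -- top-affordability closes it
    rw [div_mul_eq_mul_div, div_le_iff₀ h1y]
    have key : y * (z + (1 - z) * (1 - lam) * (S - k₁ - (a : ℝ) * g * z) / S) ≤ (1 - z) * lam * (1 - y) := by
      have eS : z + (1 - z) * (1 - lam) * (S - k₁ - (a : ℝ) * g * z) / S
          = (z * S + (1 - z) * (1 - lam) * (S - k₁ - (a : ℝ) * g * z)) / S := by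
        field_simp
      rw [eS, ← mul_div_assoc, div_le_iff₀ hS0]
      -- y[zS + (1−z)(1−λ)(S − k₁ − agz)] + y(1−z)λS = y(1−z)λk₂ − y(1−z)(1−λ)agz  (by hmean)
      have e : y * (z * S + (1 - z) * (1 - lam) * (S - k₁ - (a : ℝ) * g * z))
          = y * ((1 - z) * lam * k₂) - y * ((1 - z) * (1 - lam) * ((a : ℝ) * g * z)) - y * ((1 - z) * lam * S) + y * S * 0 + (y * S - y * S * 1) + y * (S - (1 - z) * ((k₁ : ℝ) + ((k₂ : ℝ) - k₁) * lam)) := by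
        ring
      have hS' : S - (1 - z) * ((k₁ : ℝ) + ((k₂ : ℝ) - k₁) * lam) = 0 := by rw [hmean]; ring
      rw [e, hS']
      have t1 : 0 ≤ y * ((1 - z) * (1 - lam) * ((a : ℝ) * g * z)) := mul_nonneg hy0.le (mul_nonneg (mul_nonneg h1z.le h1lam) hagz)
      have t2 : y * ((1 - z) * lam * k₂) ≤ (1 - z) * lam * S := by
        have := mul_le_mul_of_nonneg_left hyk₂ (mul_nonneg h1z.le hlam0)
        linarith [this]
      have t3 : (1 - z) * lam * (1 - y) * S = (1 - z) * lam * S - y * ((1 - z) * lam * S) := by ring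
      rw [t3]
      linarith [t1, t2]
    calc y * (z + ρ * (1 - S / h)) ≤ y * (z + (1 - z) * (1 - lam) * (S - k₁ - (a : ℝ) * g * z) / S) := by
          refine mul_le_mul_of_nonneg_left ?_ hy0.le; linarith
      _ ≤ (1 - z) * lam * (1 - y) := key
  have hP' : FlowAtT y t j (M + a) (fun p => (z + ρ * (1 - S / h)) * (if p = 0 then (1 : ℝ) else 0)
      + (1 - z) * lam * (1 - g) * (if p = k₂ then (1 : ℝ) else 0) + (1 - z) * lam * g * (if p = k₂ + a then (1 : ℝ) else 0)) := by
    have hz' : 0 ≤ z + ρ * (1 - S / h) := add_nonneg hz0 (mul_nonneg hρpos.le hw0)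
    have hm₂0 : 0 ≤ (1 - z) * lam * (1 - g) := mul_nonneg (mul_nonneg h1z.le hlam0) (by linarith)
    have hm₂'0 : 0 ≤ (1 - z) * lam * g := mul_nonneg (mul_nonneg h1z.le hlam0) hg0.le
    refine flowAtT_of_giants y t j (M + a) _ hy0 hy1 (fun p => ?_) ?_
    · refine add_nonneg (add_nonneg (mul_nonneg hz' ?_) (mul_nonneg hm₂0 ?_)) (mul_nonneg hm₂'0 ?_) <;> split_ifs <;> norm_num
    · -- lows: only the zero; giants: k₂ and k₂ + a
      have hl : ∑ l ∈ Finset.range (j + 1), (if 2 * (l : ℝ) < t then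
          (z + ρ * (1 - S / h)) * (if l = 0 then (1 : ℝ) else 0) + (1 - z) * lam * (1 - g) * (if l = k₂ then (1 : ℝ) else 0)
            + (1 - z) * lam * g * (if l = k₂ + a then (1 : ℝ) else 0) else 0) = z + ρ * (1 - S / h) := by
        have e : ∀ l ∈ Finset.range (j + 1), (if 2 * (l : ℝ) < t then
            (z + ρ * (1 - S / h)) * (if l = 0 then (1 : ℝ) else 0) + (1 - z) * lam * (1 - g) * (if l = k₂ then (1 : ℝ) else 0)
              + (1 - z) * lam * g * (if l = k₂ + a then (1 : ℝ) else 0) else 0)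
            = (z + ρ * (1 - S / h)) * (if l = 0 then (1 : ℝ) else 0) := by
          intro l hl
          have hl' : l ≤ j := Nat.lt_succ_iff.1 (Finset.mem_range.1 hl)
          rw [if_neg (show l ≠ k₂ by omega), if_neg (show l ≠ k₂ + a by omega)]
          by_cases hl0 : l = 0
          · subst hl0; rw [if_pos (by push_cast; linarith)]; ring
          · rw [if_neg hl0]; split_ifs <;> ring
        rw [Finset.sum_congr rfl e]
        exact sum_mul_indicator (fun _ => z + ρ * (1 - S / h)) j 0 (by omega)
      have hg' : ∑ p ∈ Finset.Ico (j + 1) (M + a + 1),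
          ((z + ρ * (1 - S / h)) * (if p = 0 then (1 : ℝ) else 0) + (1 - z) * lam * (1 - g) * (if p = k₂ then (1 : ℝ) else 0)
            + (1 - z) * lam * g * (if p = k₂ + a then (1 : ℝ) else 0)) = (1 - z) * lam := by
        have e : ∀ p ∈ Finset.Ico (j + 1) (M + a + 1),
            ((z + ρ * (1 - S / h)) * (if p = 0 then (1 : ℝ) else 0) + (1 - z) * lam * (1 - g) * (if p = k₂ then (1 : ℝ) else 0)
              + (1 - z) * lam * g * (if p = k₂ + a then (1 : ℝ) else 0))
              = (1 - z) * lam * (1 - g) * (if p = k₂ then (1 : ℝ) else 0) + (1 - z) * lam * g * (if p = k₂ + a then (1 : ℝ) else 0) := by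
          intro p hp
          have : p ≠ 0 := by have := (Finset.mem_Ico.1 hp).1; omega
          rw [if_neg this]; ring
        rw [Finset.sum_congr rfl e, Finset.sum_add_distrib, ← Finset.mul_sum, ← Finset.mul_sum,
          Finset.sum_ite_eq' (Finset.Ico (j + 1) (M + a + 1)) k₂, Finset.sum_ite_eq' (Finset.Ico (j + 1) (M + a + 1)) (k₂ + a),
          if_pos (Finset.mem_Ico.2 ⟨hk₂G, by omega⟩), if_pos (Finset.mem_Ico.2 ⟨by omega, by omega⟩)]
        ring
      rw [hl, hg']
      exact hineq
  -- assemble: θ·W + (1−θ)·P = θ·W' + (1−θ)·P'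
  have hflow := flowAtT_mixture_of_exchange (W := weakMidLaw S g h a)
    (P := fun p => z * (if p = 0 then (1 : ℝ) else 0) + (1 - z) * slice (fun q => TP[k₁, k₂, lam, q]) a g p)
    hθ0 hθ1.le hW' hP' (fun p => by
      rw [movedTwoPoint_apply, ← hm₁, ← hm₁']
      unfold weakMidLaw
      have e0 : θ * (1 - S / h) = (1 - θ) * (ρ * (1 - S / h)) := by linear_combination (1 - S / h) * hθρ
      have e1 : (1 - θ) * m₁ = θ * (π₁ * K₁) := by linear_combination (-(1 - θ)) * hπ₁K - (π₁ * K₁) * hθρ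
      have e2 : (1 - θ) * m₁' = θ * (πl * Kl) := by linear_combination (-(1 - θ)) * hπlK - (πl * Kl) * hθρ
      have e3 : θ * (S / h * (1 - g)) = θ * (π₁ * (S / h * (1 - g))) + θ * (πl * (S / h * (1 - g))) := by
        linear_combination (-(θ * (S / h * (1 - g)))) * hπsum
      have e4 : θ * (S / h * g) = θ * (π₁ * (S / h * g)) + θ * (πl * (S / h * g)) := by
        linear_combination (-(θ * (S / h * g))) * hπsum
      linear_combination (if p = 0 then (1 : ℝ) else 0) * e0 + (if p = k₁ then (1 : ℝ) else 0) * e1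
        + (if p = k₁ + a then (1 : ℝ) else 0) * e2 + (if p = h then (1 : ℝ) else 0) * e3 + (if p = h + a then (1 : ℝ) else 0) * e4)
  exact gatedSliceMixLaw_conclusion_of_flowAtT y z g S lam θ a j M h k₁ k₂ hy0 hy1 hhM hk hk₂M hθ0 hθ1 hflow

end LawDec

end Quant

end Summit.CriticalPhenomena.PercolationContinuityZ3.Theorems
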